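import Mathlib
import Summits.KontsevichZagierPeriods.Zeta5Search.WedgeDictionaryQuadratic
import HarnessLib

/-!
# The wedge-square dictionary on the Ball–Rivoal corner `b = (n; 0,0,0,0,0,0,0)`

Cell `pub-zeta5` (HONEST FRAMING: systematic search; no irrationality claim unless certified), planner seat GEN-1,
generation 3.  OUR work (Summit side); nothing here is a cited fact.

The conjecture `wedgeDictionary` (file `WedgeDictionary.lean`) has an 8-parameter region.  Its simplest infinite
sub-family is the CORNER `b = (n; 0⁷)` of the dual parameters, i.e. the cellular parameters
`a = (n, 0, n, 0, n, n, n, n)` (`bOfA_aCorner`), which lie in the region for every `n ≥ 1` (`converges_aCorner`,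
`region_aCorner`).  There the summand of (34) is the Ball–Rivoal-type rational function
`R_n(t) = (2t + n + 2)/((t+1)(t+2)⋯(t+n+1))⁶` (`eval_numPoly_bCorner`), and BOTH cellular-side quantities of the
`Q`-identity are available in closed form for all `n` (PROVED here):

* `QOf_aCorner`  : `Q(a) = (−1)^n` — the double sum (17) collapses to one term (`q₁ = q₅ = 0`);
* `rhoOf_aCorner` : `ρ(a) = (n!)¹⁵ / (4·(3n)!)`.

Hence (`cornerIdentity_of_wedgeDictionary`) the `Q`-part of the conjecture restricted to the corner is EQUIVALENT to
the following identity between partial-fraction coefficients of the single rational function `R_n` (through the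
j-free quadratic form `quadM3` of `WedgeDictionaryQuadratic.lean`):

  `cornerIdentity : ∀ n ≥ 1,  M₃(n; 0⁷) = U(b)W(b+e₁) − U(b+e₁)W(b) = (−1)^n · 4 · (3n)! / (n!)¹⁵`.

STATUS: CONJECTURE (tagged).  Evidence (not proof): exact rational arithmetic outside Lean for `n = 1,…,40`
(two implementations: the cell's kernel `exactrec.hgeom.impl_b` for `n ≤ 7`, and the elementary harmonic-number
form below for `n ≤ 40`); inside Lean the instances `n = 1` (`quadM3_bCorner_one`, value `−24`) and `n = 2`
(`quadM3_bCorner_two`, value `45/512`) are PROVED from explicit partial-fraction tables, and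
`Q_identity_corner_one` is the literal first conjunct of `wedgeDictionary` at `a = (1,0,1,0,1,1,1,1)` — the
instance with the smallest possible `b₀ = 1`.

ELEMENTARY FORM and LEVEL-7 STRUCTURE (verified outside Lean for `n ≤ 40`, see the cell's `PROOF-NOTES-g3.md` §2–3):
with `x_k = n − 2k`, `e_j(k) = H^{(j)}_{n−k} + (−1)^j H^{(j)}_k`, `c₁ = −6e₁, c₂ = 18e₁² + 3e₂, c₃ = −36e₁³ − 18e₁e₂ − 2e₃`,
the data of `R_n` at the pole `−(k+1)` are `(k!(n−k)!)⁻⁶ · [x_k c_r + 2c_{r−1}]` in order `6 − r`; the normalised sums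
`u_n = n!⁶U = Σ_k C(n,k)⁶ (x_k c₁ + 2)`, `w_n = n!⁶W = Σ_k C(n,k)⁶ (x_k c₃ + 2c₂)` satisfy (CONJECTURAL, tagged below;
instances `n ≤ 2` PROVED) `u_n = 2(−1)^n s₇(n)` with Cooper's sporadic level-7 numbers `s₇(n) = Σ_k C(n,k)² C(n+k,n) C(2k,n)`
(`1, 4, 48, 760, 13840, …`, recurrence `(n+1)³y_{n+1} = (2n+1)(13n²+13n+4)y_n + 3n(9n²−1)y_{n−1}`, arXiv:1210.2493 p. 2) and
`(−1)^n w_n = 28 r₇(n)`, `r₇` the companion solution; with the observed contiguity `u^S = αu + βu⁺`, `w^S = αw + βw⁺`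
(`β = −2(n+1)³/(7(3n+1))`) the corner identity is `β ·` Casoratian `= (−1)^n 16 (3n)!/(n!)³`, i.e. it reduces to two
recurrences certifiable by creative telescoping in `(n,t)` (the functionals `U = L₅`, `W = L₃` are shift-invariant) plus one
contiguity relation; numerically `r₇/s₇ → ζ(2)/7` (`W − 2ζ(2)U` recessive on the corner).
-/

open Finset Polynomial

namespace Summit.KontsevichZagierPeriods.Zeta5Search.WedgeDictionary

open Summit.KontsevichZagierPeriods.Zeta5Search.DualSeries
open Literature.NumberTheory.Irrationality.BrownZudilin2022 (bOfA QOf Converges Qcoeff pOf qOf zchoose)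
open Literature.NumberTheory.Transcendental.BallRivoal (pfEval)

/-! ### The corner parameters -/

/-- The cellular parameters of the corner: `a = (n, 0, n, 0, n, n, n, n)`. -/
def aCorner (n : ℕ) : Fin 8 → ℤ := ![(n : ℤ), 0, n, 0, n, n, n, n]

/-- The dual parameters of the corner: `b = (n; 0,0,0,0,0,0,0)` (and `0` beyond index 7). -/
def bCorner (n : ℕ) : ℕ → ℤ := fun j => if j = 0 then (n : ℤ) else 0

/-- `b(aCorner n) = (n; 0⁷)`. -/
theorem bOfA_aCorner (n : ℕ) : bOfA (aCorner n) = bCorner n := by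
  funext j
  match j with
  | 0 => simp [bOfA, aCorner, bCorner]
  | 1 => simp [bOfA, aCorner, bCorner]
  | 2 => simp [bOfA, aCorner, bCorner]
  | 3 => simp [bOfA, aCorner, bCorner]
  | 4 => simp [bOfA, aCorner, bCorner]
  | 5 => simp [bOfA, aCorner, bCorner]
  | 6 => simp [bOfA, aCorner, bCorner]
  | 7 => simp [bOfA, aCorner, bCorner]
  | k + 8 => simp [bOfA, bCorner]

/-- The corner integrals converge: all seventeen forms of (3) equal `n` or `0` at `aCorner n`. -/
theorem converges_aCorner (n : ℕ) : Converges (aCorner n) := by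
  intro x hx
  simp only [Literature.NumberTheory.Irrationality.BrownZudilin2022.convergenceForms, aCorner,
    List.mem_cons, List.not_mem_nil, or_false, Matrix.cons_val_zero, Matrix.cons_val_one,
    Matrix.cons_val] at hx
  omega

/-- `d(n; 0⁷) = 3n`. -/
theorem dOf_bCorner (n : ℕ) : dOf (bCorner n) = 3 * n := by
  simp [dOf, bCorner]

/-- The corner lies in the box of `DualSeries`. -/
theorem inBox_bCorner (n : ℕ) : InBox (bCorner n) := by
  refine ⟨by simp [bCorner], fun j _ => ?_⟩
  simp only [bCorner, Nat.add_eq_zero_iff, one_ne_zero, and_false, if_false]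
  constructor
  · exact le_rfl
  · positivity

/-- The corner lies in the region of `wedgeDictionary` (`0 ≤ 2b_i ≤ b₀ + 1`, `d ≥ 0`), and `j = 1` is an admissible
partner as soon as `n ≥ 1`. -/
theorem region_aCorner (n : ℕ) (hn : 1 ≤ n) :
    (∀ i ∈ Icc 1 7, 0 ≤ bOfA (aCorner n) i ∧ 2 * bOfA (aCorner n) i ≤ bOfA (aCorner n) 0 + 1) ∧
      0 ≤ dOf (bOfA (aCorner n)) ∧ 2 * (bOfA (aCorner n) 1 + 1) ≤ bOfA (aCorner n) 0 + 1 := by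
  rw [bOfA_aCorner, dOf_bCorner]
  refine ⟨fun i hi => ?_, by positivity, ?_⟩
  · obtain ⟨h1, _⟩ := mem_Icc.1 hi
    have hi0 : i ≠ 0 := by omega
    simp only [bCorner, hi0, if_false, if_true]
    constructor
    · exact le_rfl
    · omega
  · simp only [bCorner, one_ne_zero, if_false, if_true]
    omega

/-! ### The cellular side in closed form on the corner -/

/-- `p(aCorner n) = (n,n,n,n,n,n,n)`. -/
theorem pOf_aCorner (n : ℕ) : pOf (aCorner n) = ![(n : ℤ), n, n, n, n, n, n] := by
  funext i; fin_cases i <;> simp [pOf, aCorner]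

/-- `q(aCorner n) = (0,n,n,n,0)`. -/
theorem qOf_aCorner (n : ℕ) : qOf (aCorner n) = ![0, (n : ℤ), n, n, 0] := by
  funext i; fin_cases i <;> simp [qOf, aCorner]

/-- **`Q(aCorner n) = (−1)^n` for every `n`**: with `q₁ = q₅ = 0` the double sum (17) has the single non-zero
term `k₁ = k₂ = n`, all of whose binomials equal `1`; the sign is `(−1)^{7n}`. -/
theorem QOf_aCorner (n : ℕ) : QOf (aCorner n) = (-1) ^ n := by
  unfold QOf Qcoeff
  rw [pOf_aCorner, qOf_aCorner]
  simp only [Matrix.cons_val_zero, Matrix.cons_val_one, Matrix.cons_val, Fin.sum_univ_seven, add_zero]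
  rw [Finset.Icc_self, sum_singleton]
  rw [Finset.sum_eq_single_of_mem (n : ℤ) (by simp)]
  · have h1 : zchoose (n : ℤ) n = 1 := by simp [zchoose]
    have h2 : zchoose (n : ℤ) 0 = 1 := by simp [zchoose]
    have h3 : zchoose 0 0 = 1 := by simp [zchoose]
    simp only [sub_self, h1, h2, h3, show (n : ℤ) + n + n - n - n = n by ring,
      show (n : ℤ) + n - n - n = 0 by ring, mul_one]
    have h7 : ((n : ℤ) + n + n + n + n + n + n).toNat = 7 * n := by
      rw [show (n : ℤ) + n + n + n + n + n + n = ((7 * n : ℕ) : ℤ) by push_cast; ring, Int.toNat_natCast]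
    rw [h7, pow_mul]
    norm_num
  · intro k _ hkn
    have hz : zchoose 0 (k - n) = 0 := by
      simp only [zchoose]
      rw [if_neg]
      omega
    simp [hz]

/-- **`ρ(aCorner n) = (n!)¹⁵ / (4·(3n)!)` for every `n`**: the fifteen pair factorials are `n!`, the five single
ones are `0! = 1`, `d! = (3n)!`, and the sign is `(−1)^0`. -/
theorem rhoOf_aCorner (n : ℕ) :
    rhoOf (aCorner n) = ((n.factorial : ℚ)) ^ 15 / (4 * ((3 * n).factorial : ℚ)) := by
  unfold rhoOf
  rw [bOfA_aCorner]
  have hd : dOf (bCorner n) = ((3 * n : ℕ) : ℤ) := by simp [dOf, bCorner]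
  dsimp only
  rw [hd, Int.toNat_natCast]
  simp [Epairs, bCorner]
  ring

/-! ### The corner identity -/

/-- **CONJECTURE (the corner identity; a consequence of `wedgeDictionary`, see
`cornerIdentity_of_wedgeDictionary`).**  For every `n ≥ 1` the j-free minor of the partial-fraction data of
`R_n(t) = (2t+n+2)/((t+1)_{n+1})⁶` is
`M₃(n; 0⁷) = (−1)^n · 4 · (3n)! / (n!)¹⁵`.
Evidence (not proof): exact arithmetic for `n ≤ 40` outside Lean; `n = 1, 2` below.  INTERNALLY MINTED. -/
@[conjecture] def cornerIdentity : Prop :=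
  ∀ n : ℕ, 1 ≤ n →
    quadM3 (bCorner n) = (-1) ^ n * 4 * ((3 * n).factorial : ℚ) / ((n.factorial : ℚ)) ^ 15

/-- On the corner the literal minor of the conjecture (partner `j = 1`, `b′ = (n; 1, 0⁶)`) is the j-free form `M₃`. -/
theorem cornerMinor_eq_quadM3 (n : ℕ) :
    coeffU (bCorner n) * coeffW (Function.update (bCorner n) 1 (bCorner n 1 + 1)) -
        coeffU (Function.update (bCorner n) 1 (bCorner n 1 + 1)) * coeffW (bCorner n) =
      quadM3 (bCorner n) :=
  wedgeQ_eq_quadM3' (bCorner n) (inBox_bCorner n) (by rw [dOf_bCorner]; positivity) (by simp)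
    (by simp [bCorner])

/-- **The `Q`-part of `wedgeDictionary` implies the corner identity** (all `n ≥ 1`): at `a = aCorner n` the first
conjunct reads `(−1)^n = (n!)¹⁵/(4(3n)!) · M₃(n; 0⁷)`. -/
theorem cornerIdentity_of_wedgeDictionary (hW : wedgeDictionary) : cornerIdentity := by
  intro n hn
  obtain ⟨hreg, hd, hpart⟩ := region_aCorner n hn
  have hj : (1 : ℕ) ∈ Icc 1 7 := by simp
  have h := Q_eq_rho_mul_quadM3_of_wedgeDictionary hW (aCorner n) hj (converges_aCorner n) hreg hd hpart
  rw [QOf_aCorner, rhoOf_aCorner, bOfA_aCorner] at h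
  push_cast at h
  have hf : (n.factorial : ℚ) ≠ 0 := by positivity
  have hf3 : ((3 * n).factorial : ℚ) ≠ 0 := by positivity
  have h2 : (-1 : ℚ) ^ n * (4 * ((3 * n).factorial : ℚ)) = (n.factorial : ℚ) ^ 15 * quadM3 (bCorner n) := by
    rw [h]
    field_simp
  rw [eq_div_iff (pow_ne_zero _ hf)]
  linear_combination (-1 : ℚ) * h2

/-! ### The instances `n = 1` and `n = 2` (explicit partial fractions) -/

/-- `numPoly_{(n;0⁷)}(t+1) = 2t + n + 2`. -/
theorem eval_numPoly_bCorner (n : ℕ) (t : ℚ) :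
    ((numPoly (bCorner n)).comp (X + C 1)).eval t = 2 * t + n + 2 := by
  rw [eval_comp, eval_add, eval_X, eval_C, eval_numPoly]
  simp [bCorner, Literature.NumberTheory.Transcendental.BallRivoal.poch]
  ring

/-- `(t+1)_2 = (t+1)(t+2)`. -/
theorem poch_two (t : ℚ) : Literature.NumberTheory.Transcendental.BallRivoal.poch (t + 1) 2 = (t + 1) * (t + 2) := by
  simp only [Literature.NumberTheory.Transcendental.BallRivoal.poch, prod_range_succ, prod_range_zero, Nat.cast_zero, Nat.cast_one]
  ring

/-- `(t+1)_3 = (t+1)(t+2)(t+3)`. -/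
theorem poch_three (t : ℚ) :
    Literature.NumberTheory.Transcendental.BallRivoal.poch (t + 1) 3 = (t + 1) * (t + 2) * (t + 3) := by
  simp only [Literature.NumberTheory.Transcendental.BallRivoal.poch, prod_range_succ, prod_range_zero, Nat.cast_zero,
    Nat.cast_one, Nat.cast_ofNat]
  ring

/-- Partial-fraction data of `R_1(t) = (2t+3)/((t+1)(t+2))⁶`. -/
def cCorner1 : ℕ → ℕ → ℚ := fun o p =>
  if o = 1 ∧ p = 0 then 14 else
  if o = 1 ∧ p = 1 then -14 else
  if o = 2 ∧ p = 0 then -14 else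
  if o = 2 ∧ p = 1 then -14 else
  if o = 3 ∧ p = 0 then 9 else
  if o = 3 ∧ p = 1 then -9 else
  if o = 4 ∧ p = 0 then -4 else
  if o = 4 ∧ p = 1 then -4 else
  if o = 5 ∧ p = 0 then 1 else
  if o = 5 ∧ p = 1 then -1 else
  0

/-- Partial-fraction data of `R_2(t) = (2t+4)/((t+1)(t+2)(t+3))⁶`. -/
def cCorner2 : ℕ → ℕ → ℚ := fun o p =>
  if o = 0 ∧ p = 0 then -21 else
  if o = 0 ∧ p = 1 then 42 else
  if o = 0 ∧ p = 2 then -21 else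
  if o = 1 ∧ p = 0 then 2373 / 256 else
  if o = 1 ∧ p = 2 then -2373 / 256 else
  if o = 2 ∧ p = 0 then -453 / 128 else
  if o = 2 ∧ p = 1 then 12 else
  if o = 2 ∧ p = 2 then -453 / 128 else
  if o = 3 ∧ p = 0 then 141 / 128 else
  if o = 3 ∧ p = 2 then -141 / 128 else
  if o = 4 ∧ p = 0 then -1 / 4 else
  if o = 4 ∧ p = 1 then 2 else
  if o = 4 ∧ p = 2 then -1 / 4 else
  if o = 5 ∧ p = 0 then 1 / 32 else
  if o = 5 ∧ p = 2 then -1 / 32 else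
  0

/-- `cCorner1` is the partial-fraction data of `R_1`. -/
theorem isPFData_bCorner_one : IsPFData (bCorner 1) cCorner1 := by
  intro t ht
  have hB : (bCorner 1 0).toNat = 1 := by decide
  rw [hB] at ht ⊢
  have h1 : t + 1 ≠ 0 := by have := ht 0 (by norm_num); simpa using this
  have h2 : t + 2 ≠ 0 := by have := ht 1 (by norm_num); intro h; apply this; push_cast; linarith
  rw [eval_numPoly_bCorner, poch_two]
  simp only [pfEval, sum_range_succ, sum_range_zero, cCorner1]
  norm_num
  rw [show t + 1 + 1 = t + 2 by ring]
  field_simp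
  ring

/-- `cCorner2` is the partial-fraction data of `R_2`. -/
theorem isPFData_bCorner_two : IsPFData (bCorner 2) cCorner2 := by
  intro t ht
  have hB : (bCorner 2 0).toNat = 2 := by decide
  rw [hB] at ht ⊢
  have h1 : t + 1 ≠ 0 := by have := ht 0 (by norm_num); simpa using this
  have h2 : t + 2 ≠ 0 := by have := ht 1 (by norm_num); intro h; apply this; push_cast; linarith
  have h3 : t + 3 ≠ 0 := by have := ht 2 (by norm_num); intro h; apply this; push_cast; linarith
  rw [eval_numPoly_bCorner, poch_three]
  simp only [pfEval, sum_range_succ, sum_range_zero, cCorner2]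
  norm_num
  rw [show t + 1 + 1 = t + 2 by ring, show t + 2 + 1 = t + 3 by ring]
  field_simp
  ring

/-- `U(1;0⁷) = −8`, `W(1;0⁷) = −28`. -/
theorem coeff_bCorner_one : coeffU (bCorner 1) = -8 ∧ coeffW (bCorner 1) = -28 := by
  have hB : (bCorner 1 0).toNat = 1 := by decide
  refine ⟨?_, ?_⟩
  · rw [coeffU_eq isPFData_bCorner_one, hB]; simp only [sum_range_succ, sum_range_zero, cCorner1]; norm_num
  · rw [coeffW_eq isPFData_bCorner_one, hB]; simp only [sum_range_succ, sum_range_zero, cCorner1]; norm_num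

/-- `U(2;0⁷) = 3/2`, `W(2;0⁷) = 315/64`. -/
theorem coeff_bCorner_two : coeffU (bCorner 2) = 3 / 2 ∧ coeffW (bCorner 2) = 315 / 64 := by
  have hB : (bCorner 2 0).toNat = 2 := by decide
  refine ⟨?_, ?_⟩
  · rw [coeffU_eq isPFData_bCorner_two, hB]; simp only [sum_range_succ, sum_range_zero, cCorner2]; norm_num
  · rw [coeffW_eq isPFData_bCorner_two, hB]; simp only [sum_range_succ, sum_range_zero, cCorner2]; norm_num

/-- **Instance `n = 1` of the corner identity**: `M₃(1; 0⁷) = −24 = (−1)·4·3!/1`. -/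
theorem quadM3_bCorner_one : quadM3 (bCorner 1) = -24 := by
  have hB : (bCorner 1 0).toNat = 1 := by decide
  rw [quadM3_eq isPFData_bCorner_one, coeff_bCorner_one.1, coeff_bCorner_one.2, hB]
  simp only [sum_range_succ, sum_range_zero, cCorner1, bCorner]
  norm_num

/-- **Instance `n = 2` of the corner identity**: `M₃(2; 0⁷) = 45/512 = 4·6!/2¹⁵`. -/
theorem quadM3_bCorner_two : quadM3 (bCorner 2) = 45 / 512 := by
  have hB : (bCorner 2 0).toNat = 2 := by decide
  rw [quadM3_eq isPFData_bCorner_two, coeff_bCorner_two.1, coeff_bCorner_two.2, hB]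
  simp only [sum_range_succ, sum_range_zero, cCorner2, bCorner]
  norm_num

/-- The corner identity holds for `n = 1` and `n = 2` (unconditionally). -/
theorem cornerIdentity_le_two (n : ℕ) (hn : 1 ≤ n) (hn2 : n ≤ 2) :
    quadM3 (bCorner n) = (-1) ^ n * 4 * ((3 * n).factorial : ℚ) / ((n.factorial : ℚ)) ^ 15 := by
  interval_cases n
  · rw [quadM3_bCorner_one]; simp [Nat.factorial]; norm_num
  · rw [quadM3_bCorner_two]; simp [Nat.factorial]; norm_num

/-- **INSTANCE of the `Q`-identity of `wedgeDictionary` at `a = (1,0,1,0,1,1,1,1)` (dual parameters `(1; 0⁷)`,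
the smallest `b₀`), partner `j = 1`**, in the literal shape of the conjecture's first conjunct:
`−1 = (1/24)·(−24)`. -/
theorem Q_identity_corner_one :
    let b := bOfA (aCorner 1)
    let b' := Function.update b 1 (b 1 + 1)
    (QOf (aCorner 1) : ℚ) = rhoOf (aCorner 1) * (coeffU b * coeffW b' - coeffU b' * coeffW b) := by
  simp only [bOfA_aCorner]
  rw [cornerMinor_eq_quadM3, QOf_aCorner, rhoOf_aCorner, quadM3_bCorner_one]
  simp [Nat.factorial]
  norm_num

/-- The same at `a = (2,0,2,0,2,2,2,2)` (dual parameters `(2; 0⁷)`): `1 = (2¹⁵/(4·6!))·(45/512)`. -/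
theorem Q_identity_corner_two :
    let b := bOfA (aCorner 2)
    let b' := Function.update b 1 (b 1 + 1)
    (QOf (aCorner 2) : ℚ) = rhoOf (aCorner 2) * (coeffU b * coeffW b' - coeffU b' * coeffW b) := by
  simp only [bOfA_aCorner]
  rw [cornerMinor_eq_quadM3, QOf_aCorner, rhoOf_aCorner, quadM3_bCorner_two]
  simp [Nat.factorial]
  norm_num

/-! ### The level-7 structure of the corner coefficients (conjectural; instances proved) -/

/-- Cooper's sporadic Apéry-like numbers of level 7: `s₇(n) = Σ_{k ≤ n} C(n,k)² C(n+k,n) C(2k,n)` = `1, 4, 48, 760, 13840, …`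
(they satisfy `(n+1)³y_{n+1} = (2n+1)(13n²+13n+4)y_n + 3n(9n²−1)y_{n−1}`, arXiv:1210.2493 p. 2). -/
def cooperS7 (n : ℕ) : ℕ := ∑ k ∈ range (n + 1), n.choose k ^ 2 * (n + k).choose n * (2 * k).choose n

example : cooperS7 0 = 1 ∧ cooperS7 1 = 4 ∧ cooperS7 2 = 48 ∧ cooperS7 3 = 760 ∧ cooperS7 4 = 13840 := by decide

/-- **CONJECTURE (corner `ζ(5)`-coefficients are level-7 Apéry-like numbers; INTERNALLY MINTED, exact evidence `n ≤ 40`).**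
`n!⁶ · U(n; 0⁷) = 2 · (−1)^n · s₇(n)` for every `n`. -/
@[conjecture] def cornerU_level7 : Prop :=
  ∀ n : ℕ, (n.factorial : ℚ) ^ 6 * coeffU (bCorner n) = 2 * (-1) ^ n * (cooperS7 n : ℚ)

/-- **CONJECTURE (corner `ζ(3)`-coefficients solve the level-7 recurrence; INTERNALLY MINTED, exact evidence `n ≤ 40`).**
With `w̃_m = (−1)^m m!⁶ W(m; 0⁷)`: `(n+1)³ w̃_{n+1} = (2n+1)(13n²+13n+4) w̃_n + 3n(9n²−1) w̃_{n−1}` for `n ≥ 1`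
(and `w̃_0 = 0`, `w̃_1 = 28`, so `w̃ = 28 r₇` with `r₇` the companion solution). -/
@[conjecture] def cornerW_level7 : Prop :=
  ∀ n : ℕ, 1 ≤ n →
    ((n : ℚ) + 1) ^ 3 * ((-1) ^ (n + 1) * ((n + 1).factorial : ℚ) ^ 6 * coeffW (bCorner (n + 1))) =
      (2 * n + 1) * (13 * (n : ℚ) ^ 2 + 13 * n + 4) * ((-1) ^ n * (n.factorial : ℚ) ^ 6 * coeffW (bCorner n)) +
        3 * n * (9 * (n : ℚ) ^ 2 - 1) * ((-1) ^ (n - 1) * ((n - 1).factorial : ℚ) ^ 6 * coeffW (bCorner (n - 1)))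

/-- `(t+1)_1 = t+1`. -/
theorem poch_one (t : ℚ) : Literature.NumberTheory.Transcendental.BallRivoal.poch (t + 1) 1 = t + 1 := by
  simp only [Literature.NumberTheory.Transcendental.BallRivoal.poch, prod_range_succ, prod_range_zero, Nat.cast_zero]
  ring

/-- Partial-fraction data of `R_0(t) = (2t+2)/(t+1)⁶ = 2/(t+1)⁵`. -/
def cCorner0 : ℕ → ℕ → ℚ := fun o p => if o = 4 ∧ p = 0 then 2 else 0

/-- `cCorner0` is the partial-fraction data of `R_0`. -/
theorem isPFData_bCorner_zero : IsPFData (bCorner 0) cCorner0 := by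
  intro t ht
  have hB : (bCorner 0 0).toNat = 0 := by decide
  rw [hB] at ht ⊢
  have h1 : t + 1 ≠ 0 := by have := ht 0 (by norm_num); simpa using this
  rw [eval_numPoly_bCorner, poch_one]
  simp only [pfEval, sum_range_succ, sum_range_zero, cCorner0]
  norm_num
  field_simp

/-- `U(0;0⁷) = 2`, `W(0;0⁷) = 0`. -/
theorem coeff_bCorner_zero : coeffU (bCorner 0) = 2 ∧ coeffW (bCorner 0) = 0 := by
  have hB : (bCorner 0 0).toNat = 0 := by decide
  refine ⟨?_, ?_⟩
  · rw [coeffU_eq isPFData_bCorner_zero, hB]; simp only [sum_range_succ, sum_range_zero, cCorner0]; norm_num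
  · rw [coeffW_eq isPFData_bCorner_zero, hB]; simp only [sum_range_succ, sum_range_zero, cCorner0]; norm_num

/-- Instances `n = 0, 1, 2` of `cornerU_level7`: `(2, −8, 96) = 2·(1, −4, 48)`. -/
theorem cornerU_level7_le_two (n : ℕ) (hn : n ≤ 2) :
    (n.factorial : ℚ) ^ 6 * coeffU (bCorner n) = 2 * (-1) ^ n * (cooperS7 n : ℚ) := by
  interval_cases n
  · rw [coeff_bCorner_zero.1, show cooperS7 0 = 1 by decide]; norm_num [Nat.factorial]
  · rw [coeff_bCorner_one.1, show cooperS7 1 = 4 by decide]; norm_num [Nat.factorial]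
  · rw [coeff_bCorner_two.1, show cooperS7 2 = 48 by decide]; norm_num [Nat.factorial]

/-- Instance `n = 1` of `cornerW_level7`: `2³ · 315 = 3·30·28 + 24·0`. -/
theorem cornerW_level7_one :
    ((1 : ℚ) + 1) ^ 3 * ((-1) ^ (1 + 1) * ((1 + 1).factorial : ℚ) ^ 6 * coeffW (bCorner (1 + 1))) =
      (2 * 1 + 1) * (13 * (1 : ℚ) ^ 2 + 13 * 1 + 4) * ((-1) ^ 1 * ((1 : ℕ).factorial : ℚ) ^ 6 * coeffW (bCorner 1)) +
        3 * 1 * (9 * (1 : ℚ) ^ 2 - 1) * ((-1) ^ (1 - 1) * ((1 - 1).factorial : ℚ) ^ 6 * coeffW (bCorner (1 - 1))) := by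
  rw [coeff_bCorner_two.2, coeff_bCorner_one.2, show (1 - 1 : ℕ) = 0 from rfl, coeff_bCorner_zero.2]
  simp [Nat.factorial]
  norm_num

end Summit.KontsevichZagierPeriods.Zeta5Search.WedgeDictionary
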